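import Summits.FinalStateConjecture.FinalStateConjecture.Theses.ProbeNullTrace
import HarnessLib

/-!
# Birth skeleton (BC3) — crux stmt-FinalStateConjecture-17470 `Theses.ProbeNullTrace.CensorshipTraceNull` (rank 2)
# line `birth`: "prevalence, then Sard rigidity" (skeleton registrar planner-skel-stmt-FinalStateConjecture-17470-0, 2026-08-17)

Target, BY NAME: `Summit.FinalStateConjecture.FinalStateConjecture.Theses.ProbeNullTrace.CensorshipTraceNull`
(route file rev 5): for every admissible datum `D` (any `X`) one of whose maximal vacuum Cauchy
developments has INCOMPLETE future null infinity there are an end `e`, `k ≥ 2` and a tame (on `e`),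
immersed-at-`0`, injective, admissible `k`-probe `Φ` through `D`, `δ > 0`, a `μH[k−1]`-null set `N`
and finitely many "walls" `g_i` (differentiable at `0`, non-zero differential `L_i`) such that every
exceptional parameter `c` with `0 < ‖c‖ < δ` (some MGHD of `Φ c` fails "complete `𝓘⁺` and the
re-typed sub-extremal finitely-many-Kerr settling clause") lies in `N` or in some `{g_i = 0}`.

## Why this cut (and not "censorship trace / settling trace")

The crux is EXISTENTIAL in the probe. Two existential stubs (one bounding the censorship-failure
trace, one the settling-failure trace) cannot share their probe, and a STRUCTURAL statement
quantified over ALL smooth tame probes is cheaply refutable: precompose a transversal tame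
`3`-probe `Ψ(c, s)` with `s = f(c)`, `f` flat and vanishing exactly on countably many rays
accumulating at a line — the resulting tame, immersed, injective `2`-probe has a Lebesgue-null
exceptional trace that no finite family of walls plus `H¹`-null dust covers (for `k ≥ 3`, or for
non-immersed probes, quadratic cones / hyperbola families do the same). A universally quantified
stub is therefore stated only for probes that are REAL-ANALYTIC in the parameter near `0`,
IMMERSED, with `k = 2` — the device of the sibling route `TameStrataCurveSelection` (items
10107/10108) — which kills every reparametrisation counterexample and leaves exactly the crux's own
structural risk (laminated / Cantor thresholds, route header KILL CRITERIA).

Observation kernel-checked in the composition: a "wall" `{g = 0}`, `g` differentiable at `0` with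
`dg(0) = L ≠ 0`, is precisely a subset of a PINCHED CUSP `{c : |L c| ≤ ε(‖c‖) ‖c‖}`, `ε → 0`;
conversely every subset of such a cusp is the zero set of such a `g` (take `g = L` off the set, `0`
on it). So the crux's cover reads: "`μH[k−1]`-null dust, plus exceptional parameters accumulating
at `0` tangentially to finitely many hyperplanes". The line accordingly splits the crux into

* `stub_aeGoodAnalyticProbe` — PREVALENCE HALF (the physics; Hunt–Sauer–Yorke shadow of "almost
  every kick censors and settles"): through every admissible naked-singularity-type datum passes a
  tame, immersed, injective, admissible `2`-probe, real-analytic in `c` near `0`, along which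
  Lebesgue-almost every small parameter is GOOD. Open-problem sized (instability of naked
  singularities under SMOOTH same-end kicks — the open side of barrier
  `Literature.Barriers.FinalStateConjecture.nakedSingularityInstability` — plus large-data
  sub-extremal Kerr settling with honest future-oriented charts, in almost-every form).
* `stub_nullTraceTangentLines` — SARD / TAMENESS HALF (geometry of the thresholds): along EVERY
  such analytic tame immersed injective admissible `2`-probe through such a datum whose exceptional
  trace is Lebesgue-null near `0`, the exceptional parameters near `0` lie in an `H¹`-null set or in
  finitely many pinched cusps around lines through `0`. Open-problem sized (no laminated or fractal
  black-hole / naked-singularity thresholds accumulating at the datum: uncertainty exponent of the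
  collapse basin boundary along `2`-parameter families, SzybkaChmaj2008, GundlachMartingarcia2007;
  hyperbolicity of critical solutions).

and `CensorshipTraceNull_of : Sig.stub_aeGoodAnalyticProbe → Sig.stub_nullTraceTangentLines →
CensorshipTraceNull` (sorry-free; the `Sig.*` legend = the stub signatures verbatim so that the
implication has named binders) builds the walls `g_i c := if |L_i c| ≤ ε(‖c‖)‖c‖ then 0 else L_i c`,
proves `HasFDerivAt (g_i) (L_i) 0` by the little-`o` estimate `|g_i c − L_i c| ≤ max(ε ‖c‖, 0)·‖c‖`,
and instantiates the crux with `k = 2`; `censorshipTraceNull_of_stubs : CensorshipTraceNull` is the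
crux BY NAME, closed modulo the two registered stubs. The two stubs separate the two independent
risks of the crux: numerical relativity bears on them differently (basin MEASURE of collapse vs
basin-BOUNDARY DIMENSION, cf. route header CHEAPEST FALSIFIER).

Disproof used: no `Cruxes/CensorshipTraceNull/Disproof.lean` exists (`ledger crux ls` empty at
registration; no `_false_without_` obligations, no landed Negative lemma for this decl or its
predecessor stmt-9962). Negatives index (`ledger negatives --problem FinalStateConjecture`, 1 entry,
`not_UniformPhotonSphereChannels`): unrelated ODE estimate. Dead lines: none recorded on the crux.
-/

set_option linter.dupNamespace false

noncomputable section

open scoped Manifold ContDiff Topology MeasureTheory ENNReal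
open Filter Set Function MeasureTheory Literature.Geometry.Lorentzian

namespace Summit.FinalStateConjecture.FinalStateConjecture.Cruxes.CensorshipTraceNull.Birth

open Summit.FinalStateConjecture.FinalStateConjecture.Theses.ProbeNullTrace (CensorshipTraceNull)

/-! ## Legend: the two stub statements as named propositions (verbatim the registered signatures) -/

/-- Statement of `stub_aeGoodAnalyticProbe`: through every admissible datum with an MGHD of
incomplete `𝓘⁺` passes a tame, immersed, injective, admissible `2`-probe, real-analytic in the
parameter near `0`, along which Lebesgue-a.e. small parameter is good. -/
def Sig.stub_aeGoodAnalyticProbe : Prop :=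
  open scoped Manifold MeasureTheory in ∀ (X : Type) [TopologicalSpace X] [ChartedSpace Literature.Geometry.Lorentzian.E3 X] [IsManifold (𝓡 3) ((⊤ : ℕ∞) : WithTop ℕ∞) X] [T2Space X] [SecondCountableTopology X] [ConnectedSpace X], ∀ D ∈ Literature.Geometry.Lorentzian.admissibleVacuumData X, (∃ 𝒟 : Literature.Geometry.Lorentzian.VacuumCauchyDevelopment D, 𝒟.IsMaximal ∧ ¬ Summit.FinalStateConjecture.HasCompleteNullInfinity 𝒟.toCauchyDevelopment) → ∃ (e : Literature.Geometry.Lorentzian.AFEnd X) (Φ : EuclideanSpace ℝ (Fin 2) → Literature.Geometry.Lorentzian.InitialDataSet (𝓡 3) X), Literature.Geometry.Lorentzian.InitialDataSet.IsTameDataFamily e 2 Φ ∧ Literature.Geometry.Lorentzian.InitialDataSet.IsImmersedAtZero 2 Φ ∧ Function.Injective Φ ∧ Φ 0 = D ∧ (∀ c, Φ c ∈ Literature.Geometry.Lorentzian.admissibleVacuumData X) ∧ (∃ r : ℝ, 0 < r ∧ ∀ (x : X) (v w : TangentSpace (𝓡 3) x), AnalyticOnNhd ℝ (fun c ↦ (Φ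 c).h.inner x v w) (Metric.ball 0 r) ∧ AnalyticOnNhd ℝ (fun c ↦ (Φ c).k x v w) (Metric.ball 0 r)) ∧ ∃ δ : ℝ, 0 < δ ∧ MeasureTheory.volume {c : EuclideanSpace ℝ (Fin 2) | ‖c‖ < δ ∧ ¬ (∀ 𝒟 : Literature.Geometry.Lorentzian.VacuumCauchyDevelopment (Φ c), 𝒟.IsMaximal → Summit.FinalStateConjecture.HasCompleteNullInfinity 𝒟.toCauchyDevelopment ∧ ∃ (O : Set 𝒟.carrier) (d : Literature.Geometry.Lorentzian.FinalStateDecomposition 𝒟.toSpacetime O 2), (∀ i, Literature.Geometry.Lorentzian.Kerr.IsSubextremal (d.mass i) (d.spin i)) ∧ O = Summit.FinalStateConjecture.exteriorOf 𝒟.toCauchyDevelopment d.charted ∧ Summit.FinalStateConjecture.RaysStayInClosure 𝒟.toCauchyDevelopment O ∧ Summit.FinalStateConjecture.HasExhaustiveCharts d ∧ Summit.FinalStateConjecture.IsFutureOriented d)} = 0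

/-- Statement of `stub_nullTraceTangentLines`: along every analytic tame immersed injective
admissible `2`-probe through such a datum with Lebesgue-null exceptional trace near `0`, the
exceptional parameters near `0` are `H¹`-null dust or hug finitely many lines through `0`. -/
def Sig.stub_nullTraceTangentLines : Prop :=
  open scoped Manifold MeasureTheory in ∀ (X : Type) [TopologicalSpace X] [ChartedSpace Literature.Geometry.Lorentzian.E3 X] [IsManifold (𝓡 3) ((⊤ : ℕ∞) : WithTop ℕ∞) X] [T2Space X] [SecondCountableTopology X] [ConnectedSpace X], ∀ D ∈ Literature.Geometry.Lorentzian.admissibleVacuumData X, (∃ 𝒟 : Literature.Geometry.Lorentzian.VacuumCauchyDevelopment D, 𝒟.IsMaximal ∧ ¬ Summit.FinalStateConjecture.HasCompleteNullInfinity 𝒟.toCauchyDevelopment) → ∀ (e : Literature.Geometry.Lorentzian.AFEnd X) (Φ : EuclideanSpace ℝ (Fin 2) → Literature.Geometry.Lorentzian.InitialDataSet (𝓡 3) X), Literature.Geometry.Lorentzian.InitialDataSet.IsTameDataFamily e 2 Φ → Literature.Geometry.Lorentzian.InitialDataSet.IsImmersedAtZero 2 Φ → Function.Injective Φ → Φ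 0 = D → (∀ c, Φ c ∈ Literature.Geometry.Lorentzian.admissibleVacuumData X) → (∃ r : ℝ, 0 < r ∧ ∀ (x : X) (v w : TangentSpace (𝓡 3) x), AnalyticOnNhd ℝ (fun c ↦ (Φ c).h.inner x v w) (Metric.ball 0 r) ∧ AnalyticOnNhd ℝ (fun c ↦ (Φ c).k x v w) (Metric.ball 0 r)) → ∀ δ : ℝ, 0 < δ → MeasureTheory.volume {c : EuclideanSpace ℝ (Fin 2) | ‖c‖ < δ ∧ ¬ (∀ 𝒟 : Literature.Geometry.Lorentzian.VacuumCauchyDevelopment (Φ c), 𝒟.IsMaximal → Summit.FinalStateConjecture.HasCompleteNullInfinity 𝒟.toCauchyDevelopment ∧ ∃ (O : Set 𝒟.carrier) (d : Literature.Geometry.Lorentzian.FinalStateDecomposition 𝒟.toSpacetime O 2), (∀ i, Literature.Geometry.Lorentzian.Kerr.IsSubextremal (d.mass i) (d.spin i)) ∧ O = Summit.FinalStateConjecture.exteriorOf 𝒟.toCauchyDevelopment d.charted ∧ Summit.FinalStateConjecture.RaysStayInClosure 𝒟.toCauchyDevelopment O ∧ Summit.FinalStateConjecture.HasExhaustiveCharts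 d ∧ Summit.FinalStateConjecture.IsFutureOriented d)} = 0 → ∃ (δ' : ℝ) (N : Set (EuclideanSpace ℝ (Fin 2))) (m : ℕ) (L : Fin m → (EuclideanSpace ℝ (Fin 2) →L[ℝ] ℝ)) (ε : ℝ → ℝ), 0 < δ' ∧ μH[1] N = 0 ∧ (∀ i, L i ≠ 0) ∧ Filter.Tendsto ε (nhdsWithin 0 (Set.Ioi 0)) (nhds 0) ∧ ∀ c, ‖c‖ < δ' → c ≠ 0 → ¬ (∀ 𝒟 : Literature.Geometry.Lorentzian.VacuumCauchyDevelopment (Φ c), 𝒟.IsMaximal → Summit.FinalStateConjecture.HasCompleteNullInfinity 𝒟.toCauchyDevelopment ∧ ∃ (O : Set 𝒟.carrier) (d : Literature.Geometry.Lorentzian.FinalStateDecomposition 𝒟.toSpacetime O 2), (∀ i, Literature.Geometry.Lorentzian.Kerr.IsSubextremal (d.mass i) (d.spin i)) ∧ O = Summit.FinalStateConjecture.exteriorOf 𝒟.toCauchyDevelopment d.charted ∧ Summit.FinalStateConjecture.RaysStayInClosure 𝒟.toCauchyDevelopment O ∧ Summit.FinalStateConjecture.HasExhaustiveCharts d ∧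 Summit.FinalStateConjecture.IsFutureOriented d) → c ∈ N ∨ ∃ i, |L i c| ≤ ε ‖c‖ * ‖c‖

/-! ## Registered stubs (`sorry` only here; signatures def-free and self-contained) -/

/-- **Stub 1 — PREVALENCE HALF: an analytic tame `2`-probe along which almost every small kick is
good.** For every connected Hausdorff second-countable `3`-manifold `X` and every admissible vacuum
datum `D` one of whose maximal vacuum Cauchy developments has INCOMPLETE future null infinity, there
are ONE asymptotically flat end `e` of `X` and a `2`-parameter family `Φ` of admissible data, tame on
`e` (`IsTameDataFamily`: jointly smooth, every member Dafermos–Rodnianski-flat on `e` with continuous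
mass, `wDist`-continuous at `0`), immersed at `0`, injective, with `Φ 0 = D`, whose scalar
components `c ↦ h_c(x)(v,w)`, `c ↦ k_c(x)(v,w)` are real-analytic on one ball `‖c‖ < r`, and a
`δ > 0` such that the set of parameters `‖c‖ < δ` at which `Φ c` is EXCEPTIONAL (some MGHD fails
"complete `𝓘⁺` and a sub-extremal finitely-many-Kerr `FinalStateDecomposition` of
`O = exteriorOf` with `RaysStayInClosure`, `HasExhaustiveCharts`, `IsFutureOriented`") is
LEBESGUE-NULL. Physically: `D` plus two small same-end gravitational-wave kicks glued at finite
radius (analytic in the amplitudes by the implicit function theorem for the polynomial constraint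
map); almost every kick makes a trapped surface form before the first singularity (the
Christodoulou–Liu–Li–An mechanism, here demanded for SMOOTH kicks of vacuum data — the open side of
barrier `nakedSingularityInstability`, whose proved instability is a rough-kick/BV effect) or
disperses, and the resulting black holes settle to honestly charted sub-extremal Kerrs (large-data
Kerr capture, known only for `|a| ≪ M`, KlainermanSzeftel2023). The per-datum finite-dimensional
shadow of Hunt–Sauer–Yorke prevalence ("the exceptional set is shy"). Why it might fail: smooth
kicks may leave a `k`-self-similar naked singularity with incomplete `𝓘⁺` on a POSITIVE-measure set
of amplitudes (Singh, arXiv:2402.00062; arXiv:2210.11325, Thm. 5); Kerr capture far from `|a| ≪ M`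
is open; analyticity in `c` must survive the gluing. Sources: Christodoulou1999instability (Thm. 4.1),
LiuLi2018, An2025, HuntSauerYorke1992, RodnianskiShlapentokhRothman2023, KlainermanSzeftel2023,
arXiv:2605.16235. Size: open problem. -/
theorem stub_aeGoodAnalyticProbe : open scoped Manifold MeasureTheory in ∀ (X : Type) [TopologicalSpace X] [ChartedSpace Literature.Geometry.Lorentzian.E3 X] [IsManifold (𝓡 3) ((⊤ : ℕ∞) : WithTop ℕ∞) X] [T2Space X] [SecondCountableTopology X] [ConnectedSpace X], ∀ D ∈ Literature.Geometry.Lorentzian.admissibleVacuumData X, (∃ 𝒟 : Literature.Geometry.Lorentzian.VacuumCauchyDevelopment D, 𝒟.IsMaximal ∧ ¬ Summit.FinalStateConjecture.HasCompleteNullInfinity 𝒟.toCauchyDevelopment) → ∃ (e : Literature.Geometry.Lorentzian.AFEnd X) (Φ : EuclideanSpace ℝ (Fin 2) → Literature.Geometry.Lorentzian.InitialDataSet (𝓡 3) X), Literature.Geometry.Lorentzian.InitialDataSet.IsTameDataFamily e 2 Φ ∧ Literature.Geometry.Lorentzian.InitialDataSet.IsImmersedAtZero 2 Φ ∧ Function.Injective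 Φ ∧ Φ 0 = D ∧ (∀ c, Φ c ∈ Literature.Geometry.Lorentzian.admissibleVacuumData X) ∧ (∃ r : ℝ, 0 < r ∧ ∀ (x : X) (v w : TangentSpace (𝓡 3) x), AnalyticOnNhd ℝ (fun c ↦ (Φ c).h.inner x v w) (Metric.ball 0 r) ∧ AnalyticOnNhd ℝ (fun c ↦ (Φ c).k x v w) (Metric.ball 0 r)) ∧ ∃ δ : ℝ, 0 < δ ∧ MeasureTheory.volume {c : EuclideanSpace ℝ (Fin 2) | ‖c‖ < δ ∧ ¬ (∀ 𝒟 : Literature.Geometry.Lorentzian.VacuumCauchyDevelopment (Φ c), 𝒟.IsMaximal → Summit.FinalStateConjecture.HasCompleteNullInfinity 𝒟.toCauchyDevelopment ∧ ∃ (O : Set 𝒟.carrier) (d : Literature.Geometry.Lorentzian.FinalStateDecomposition 𝒟.toSpacetime O 2), (∀ i, Literature.Geometry.Lorentzian.Kerr.IsSubextremal (d.mass i) (d.spin i)) ∧ O = Summit.FinalStateConjecture.exteriorOf 𝒟.toCauchyDevelopment d.charted ∧ Summit.FinalStateConjecture.RaysStayInClosure 𝒟.toCauchyDevelopment O ∧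 Summit.FinalStateConjecture.HasExhaustiveCharts d ∧ Summit.FinalStateConjecture.IsFutureOriented d)} = 0 := by
  sorry

/-- **Stub 2 — SARD / TAMENESS HALF: a Lebesgue-null exceptional trace along an analytic tame
`2`-probe is `H¹`-null dust plus finitely many tangent lines.** For every admissible datum `D` with
an MGHD of incomplete `𝓘⁺`, every end `e` and EVERY `2`-parameter family `Φ` of admissible data
through `D = Φ 0` that is tame on `e`, immersed at `0`, injective and real-analytic in the parameter
on a ball `‖c‖ < r`, and every `δ > 0` for which the exceptional parameters in `‖c‖ < δ` form a
LEBESGUE-NULL set: there are `δ' > 0`, an `H¹`-null set `N ⊆ ℝ²`, finitely many non-zero linear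
functionals `L_i` and a modulus `ε` with `ε(s) → 0` as `s → 0⁺`, such that every exceptional `c`
with `0 < ‖c‖ < δ'` lies in `N` or satisfies `|L_i c| ≤ ε(‖c‖) ‖c‖` for some `i` — the exceptional
parameters accumulate at `0` only inside pinched cusps around FINITELY MANY LINES, up to dust of
zero length. The geometric-measure-theoretic regularity of the black-hole / naked-singularity
thresholds seen through the probe: codimension-one strata through `D` are `C¹` at `D` along the
probe (hyperbolic critical solutions: one unstable mode, GundlachMartingarcia2007 §3; the
codimension-`3` `C¹` Schwarzschild-forming family of arXiv:2104.08222 is of this type), higher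
strata have zero length. Analyticity and immersion of the probe are what make the universal
quantifier honest: smooth or non-immersed reparametrisations manufacture Lebesgue-null,
non-coverable traces (flat functions vanishing on accumulating rays; quadratic cones) from any
transversal probe. Why it might fail: a LAMINATED or FRACTAL threshold accumulating at `D`
(countably many threshold sheets converging to the sheet through `D`; chaotic critical collapse with
basin-boundary uncertainty exponent `α < 1`, SzybkaChmaj2008 in `4+1` Bianchi IX vacuum; competing
critical solutions in vacuum Brill-wave collapse, arXiv:2305.17171) gives a Lebesgue-null trace of
positive `H¹`-measure with infinitely many tangent directions — then the crux is false at `D` as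
well (route KILL CRITERIA), so this stub isolates exactly the structural bet of the line. Sources:
Christodoulou1999instability (Thm. 4.1: empty punctured trace, the `N = ∅`, `m = 0` case),
GundlachMartingarcia2007, SzybkaChmaj2008, arXiv:2104.08222, arXiv:2305.17171, EvansGariepy2015,
Mattila1995. Size: open problem. -/
theorem stub_nullTraceTangentLines : open scoped Manifold MeasureTheory in ∀ (X : Type) [TopologicalSpace X] [ChartedSpace Literature.Geometry.Lorentzian.E3 X] [IsManifold (𝓡 3) ((⊤ : ℕ∞) : WithTop ℕ∞) X] [T2Space X] [SecondCountableTopology X] [ConnectedSpace X], ∀ D ∈ Literature.Geometry.Lorentzian.admissibleVacuumData X, (∃ 𝒟 : Literature.Geometry.Lorentzian.VacuumCauchyDevelopment D, 𝒟.IsMaximal ∧ ¬ Summit.FinalStateConjecture.HasCompleteNullInfinity 𝒟.toCauchyDevelopment) → ∀ (e : Literature.Geometry.Lorentzian.AFEnd X) (Φ : EuclideanSpace ℝ (Fin 2) → Literature.Geometry.Lorentzian.InitialDataSet (𝓡 3) X), Literature.Geometry.Lorentzian.InitialDataSet.IsTameDataFamily e 2 Φ → Literature.Geometry.Lorentzian.InitialDataSet.IsImmersedAtZero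 2 Φ → Function.Injective Φ → Φ 0 = D → (∀ c, Φ c ∈ Literature.Geometry.Lorentzian.admissibleVacuumData X) → (∃ r : ℝ, 0 < r ∧ ∀ (x : X) (v w : TangentSpace (𝓡 3) x), AnalyticOnNhd ℝ (fun c ↦ (Φ c).h.inner x v w) (Metric.ball 0 r) ∧ AnalyticOnNhd ℝ (fun c ↦ (Φ c).k x v w) (Metric.ball 0 r)) → ∀ δ : ℝ, 0 < δ → MeasureTheory.volume {c : EuclideanSpace ℝ (Fin 2) | ‖c‖ < δ ∧ ¬ (∀ 𝒟 : Literature.Geometry.Lorentzian.VacuumCauchyDevelopment (Φ c), 𝒟.IsMaximal → Summit.FinalStateConjecture.HasCompleteNullInfinity 𝒟.toCauchyDevelopment ∧ ∃ (O : Set 𝒟.carrier) (d : Literature.Geometry.Lorentzian.FinalStateDecomposition 𝒟.toSpacetime O 2), (∀ i, Literature.Geometry.Lorentzian.Kerr.IsSubextremal (d.mass i) (d.spin i)) ∧ O = Summit.FinalStateConjecture.exteriorOf 𝒟.toCauchyDevelopment d.charted ∧ Summit.FinalStateConjecture.RaysStayInClosure 𝒟.toCauchyDevelopment O ∧ Summit.FinalStateConjecture.HasExhaustiveCharts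 d ∧ Summit.FinalStateConjecture.IsFutureOriented d)} = 0 → ∃ (δ' : ℝ) (N : Set (EuclideanSpace ℝ (Fin 2))) (m : ℕ) (L : Fin m → (EuclideanSpace ℝ (Fin 2) →L[ℝ] ℝ)) (ε : ℝ → ℝ), 0 < δ' ∧ μH[1] N = 0 ∧ (∀ i, L i ≠ 0) ∧ Filter.Tendsto ε (nhdsWithin 0 (Set.Ioi 0)) (nhds 0) ∧ ∀ c, ‖c‖ < δ' → c ≠ 0 → ¬ (∀ 𝒟 : Literature.Geometry.Lorentzian.VacuumCauchyDevelopment (Φ c), 𝒟.IsMaximal → Summit.FinalStateConjecture.HasCompleteNullInfinity 𝒟.toCauchyDevelopment ∧ ∃ (O : Set 𝒟.carrier) (d : Literature.Geometry.Lorentzian.FinalStateDecomposition 𝒟.toSpacetime O 2), (∀ i, Literature.Geometry.Lorentzian.Kerr.IsSubextremal (d.mass i) (d.spin i)) ∧ O = Summit.FinalStateConjecture.exteriorOf 𝒟.toCauchyDevelopment d.charted ∧ Summit.FinalStateConjecture.RaysStayInClosure 𝒟.toCauchyDevelopment O ∧ Summit.FinalStateConjecture.HasExhaustiveCharts d ∧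 Summit.FinalStateConjecture.IsFutureOriented d) → c ∈ N ∨ ∃ i, |L i c| ≤ ε ‖c‖ * ‖c‖ := by
  sorry

/-! ## The wall lemma (sorry-free): a linear functional zeroed on a pinched cusp is differentiable
at `0` with the same differential -/

/-- **Pinched cusps are walls.** If `ε(s) → 0` as `s → 0⁺` and `L` is a continuous linear functional
on a real normed space, the function `g c := if |L c| ≤ ε ‖c‖ * ‖c‖ then 0 else L c` has
`HasFDerivAt g L 0`: indeed `|g c − L c| ≤ max (ε ‖c‖) 0 * ‖c‖ = o(‖c‖)`. So every subset of the
cusp `{c : |L c| ≤ ε(‖c‖) ‖c‖}` lies in the zero set of a function differentiable at `0` with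
differential `L` — the converse reading of the crux's walls. [folklore] -/
theorem hasFDerivAt_cuspWall {V : Type*} [NormedAddCommGroup V] [NormedSpace ℝ V]
    (L : V →L[ℝ] ℝ) {ε : ℝ → ℝ} (hε : Tendsto ε (𝓝[>] 0) (𝓝 0)) :
    HasFDerivAt (fun c : V ↦ if |L c| ≤ ε ‖c‖ * ‖c‖ then (0 : ℝ) else L c) L 0 := by
  rw [hasFDerivAt_iff_isLittleO_nhds_zero]
  refine Asymptotics.isLittleO_iff.2 fun κ hκ ↦ ?_
  -- `ε s < κ` for `0 < s < η`
  have hev : ∀ᶠ s in 𝓝[>] (0 : ℝ), |ε s| < κ := by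
    have h := (hε.eventually (Metric.ball_mem_nhds (0 : ℝ) hκ))
    filter_upwards [h] with s hs
    simpa [Real.dist_eq] using hs
  obtain ⟨η, hη, hball⟩ : ∃ η > 0, ∀ s : ℝ, 0 < s → s < η → |ε s| < κ := by
    rcases (Metric.nhdsWithin_basis_ball (s := Set.Ioi (0 : ℝ)) (x := 0)).eventually_iff.1 hev
      with ⟨η, hη, h⟩
    refine ⟨η, hη, fun s hs hsη ↦ h ⟨?_, hs⟩⟩
    simpa [Real.dist_eq, abs_of_pos hs] using hsη
  have h0 : (if |L (0 : V)| ≤ ε ‖(0 : V)‖ * ‖(0 : V)‖ then (0 : ℝ) else L 0) = 0 := by simp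
  filter_upwards [Metric.ball_mem_nhds (0 : V) hη] with c hc
  rw [zero_add, h0, sub_zero]
  by_cases hcond : |L c| ≤ ε ‖c‖ * ‖c‖
  · rw [if_pos hcond, zero_sub, norm_neg, Real.norm_eq_abs]
    by_cases hc0 : c = 0
    · subst hc0; simp
    · have hpos : 0 < ‖c‖ := norm_pos_iff.2 hc0
      have hcη : ‖c‖ < η := by simpa using hc
      have hεκ : ε ‖c‖ ≤ κ := (le_abs_self _).trans (hball ‖c‖ hpos hcη).le
      calc |L c| ≤ ε ‖c‖ * ‖c‖ := hcond
        _ ≤ κ * ‖c‖ := mul_le_mul_of_nonneg_right hεκ hpos.le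
  · rw [if_neg hcond, sub_self, norm_zero]
    positivity

/-! ## Composition: the crux BY NAME from the two stubs (real proof, no `sorry`) -/

/-- **`CensorshipTraceNull` from prevalence and Sard rigidity.** Stub 1 gives, through the
naked-singularity-type datum `D`, an analytic tame immersed injective admissible `2`-probe `Φ` with
Lebesgue-null exceptional trace on `‖c‖ < δ`; stub 2, applied to THIS probe, returns `δ'`, the
`H¹`-null dust `N`, finitely many non-zero functionals `L_i` and a modulus `ε → 0`; the walls of the
crux are `g_i c := if |L_i c| ≤ ε(‖c‖)‖c‖ then 0 else L_i c` (`hasFDerivAt_cuspWall`: differentiable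
at `0` with differential `L_i ≠ 0`), they vanish at every cusp point, and the crux holds with
`k = 2` (`μH[(2 : ℕ) - 1] = μH[1]`). -/
theorem CensorshipTraceNull_of :
    Sig.stub_aeGoodAnalyticProbe → Sig.stub_nullTraceTangentLines → CensorshipTraceNull := by
  intro h₁ h₂ X _ _ _ _ _ _ D hD hNS
  obtain ⟨e, Φ, htame, himm, hinj, h0, hadm, han, δ, hδ, hnull⟩ := h₁ X D hD hNS
  obtain ⟨δ', N, m, L, ε, hδ', hN, hL, hε, hcov⟩ :=
    h₂ X D hD hNS e Φ htame himm hinj h0 hadm han δ hδ hnull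
  -- the walls
  let g : Fin m → EuclideanSpace ℝ (Fin 2) → ℝ :=
    fun i c ↦ if |L i c| ≤ ε ‖c‖ * ‖c‖ then 0 else L i c
  have hg : ∀ i, HasFDerivAt (g i) (L i) 0 := fun i ↦ hasFDerivAt_cuspWall (L i) hε
  refine ⟨e, 2, Φ, le_rfl, htame, himm, hinj, h0, hadm, δ', N, m, g, L, hδ', ?_,
    fun i ↦ ⟨hg i, hL i⟩, ?_⟩
  · -- `μH[(2 : ℕ) - 1] N = μH[1] N = 0`
    have h21 : ((2 : ℕ) : ℝ) - 1 = 1 := by norm_num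
    rw [h21]
    exact hN
  · intro c hc hc0 hbad
    rcases hcov c hc hc0 hbad with hcN | ⟨i, hi⟩
    · exact Or.inl hcN
    · exact Or.inr ⟨i, if_pos hi⟩

/-- The crux by name, closed modulo the two registered stubs. -/
theorem censorshipTraceNull_of_stubs : CensorshipTraceNull :=
  CensorshipTraceNull_of stub_aeGoodAnalyticProbe stub_nullTraceTangentLines

end Summit.FinalStateConjecture.FinalStateConjecture.Cruxes.CensorshipTraceNull.Birth

end
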